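import Summits.BirchSwinnertonDyer.BirchSwinnertonDyer.Theorems.GenusKolyvaginAtTwoTorsionCellSELBorderedCount
import HarnessLib

/-!
# SEL (iso-class Selmer pair law), C1-D: the unified `C₁` system has exactly `8 · #ker Φ₃(B)` solutions

Crux R″ `RankOneTwoTorsionResidualAtTwo` (stmt-27478), LINE 49 «full_vertex», SUPPORT stub SEL
`IsoClassSelmerPairLawAtTwo`, the `C₁` conjunct (LEAD memo `Cruxes/…/Lines/torsion_cell_full_vertex_SEL_C1_road_g36.md`,
§3 THEOREM).  With `B = borderedLaplacian Q p₀` for a set `Q` of primes `≡ 3 (mod 4)` of even size, any border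
`π j = [−p₀/qⱼ]` and any bit `ε`:

* `card_goodScalars` — exactly `8` of the `32` scalar vectors `s = (σ, τ₁, τ₂, γ₁, γ₂)` satisfy the fibre condition
  `cond(s)` of part C1-C, whatever the transfer bits `f, g` with `f·g = 0` (a finite check);
* **`natCard_sysC1_eq`** — the solution set of the unified system (Qa) ∧ (Qb) ∧ (Pa) ∧ (Pb) ∧ (∞) in
  `(s, χ₁, χ₂)` has exactly `8 · #ker Φ₃(B)` elements (fibres `≅ ker Φ₃(B)` over the good scalars, empty otherwise).

This is the `𝔽₂` count behind `#Sel⁽²⁾(E₀^{(−p₀M)}) = 8 · #ker Φ₃(B)`; the descent identification of the Selmer group with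
the solution set is parts C1-E…H.  Everything is proved; no LINE 49 statement is restated; BSD is not advanced by this
file alone.

## References

* [HeathBrown1994SelmerCongruentII] D. R. Heath-Brown, Invent. Math. 118 (1994), §2 (Laplacian/tournament linear algebra).
* [Kane2013SelmerTwists] D. M. Kane, Algebra Number Theory 7 (2013), §2.
-/

namespace Summit.BirchSwinnertonDyer.BirchSwinnertonDyer.Theorems.GenusKolyvaginAtTwo.FullVertex

open Matrix

/-! ## The eight good scalar vectors -/

/-- **Exactly 8 good scalar vectors**: for transfer bits with `F = P`, `F = f + g`, `f g = 0`, the conditions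
`γ₁+γ₂+τ₁+τ₂ = σ`, `A P + C g = σ`, `A f + C F = (1+ε)σ` (`A = εγ₁+γ₂+τ₁+ετ₂+(1+ε)σ`, `C = τ₂+γ₁+σ`) hold for exactly
`8` of the `32` vectors `s = (σ, τ₁, τ₂, γ₁, γ₂)`. [folklore] -/
theorem card_goodScalars (ε f g F P : ZMod 2) (hFP : F = P) (hFfg : F = f + g) (hfg : f * g = 0) :
    (Finset.univ.filter fun s : ZMod 2 × ZMod 2 × ZMod 2 × ZMod 2 × ZMod 2 =>
      (s.2.2.2.1 + s.2.2.2.2 + s.2.1 + s.2.2.1 = s.1) ∧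
      ((ε * s.2.2.2.1 + s.2.2.2.2 + s.2.1 + ε * s.2.2.1 + (1 + ε) * s.1) * P + (s.2.2.1 + s.2.2.2.1 + s.1) * g = s.1) ∧
      ((ε * s.2.2.2.1 + s.2.2.2.2 + s.2.1 + ε * s.2.2.1 + (1 + ε) * s.1) * f + (s.2.2.1 + s.2.2.2.1 + s.1) * F
        = (1 + ε) * s.1)).card = 8 := by
  revert ε f g F P; decide

variable (Q : Finset ℕ) (p₀ : ℕ) (hQ : ∀ q ∈ Q, q.Prime) (hQ4 : ∀ q ∈ Q, q % 4 = 3) (hk : Even Q.card)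
include hQ hQ4 hk

/-! ## The count -/

/-- **`#Sol(SysC1) = 8 · #ker Φ₃(B)`**: the unified `C₁` system in the scalars `s = (σ, τ₁, τ₂, γ₁, γ₂)` (the components
of `s` in this order) and the vectors `χ₁, χ₂ : Q → 𝔽₂` has exactly `8 · #ker Φ₃(B)` solutions.
[cite: HeathBrown1994SelmerCongruentII, §2] [cite: Kane2013SelmerTwists, §2] -/
theorem natCard_sysC1_eq (ε : ZMod 2) :
    Nat.card {x : (ZMod 2 × ZMod 2 × ZMod 2 × ZMod 2 × ZMod 2) × ((Q → ZMod 2) × (Q → ZMod 2)) //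
      (∀ j : Q, (borderedLaplacian Q p₀ *ᵥ x.2.1) j + ε * x.2.1 j + x.2.2 j =
          x.1.2.2.2.1 * legendreBit (-(p₀ : ℤ)) (j : ℕ) + (x.1.2.1 + ε * x.1.2.2.1 + ∑ i : Q, x.2.1 i)) ∧
      (∀ j : Q, (borderedLaplacian Q p₀ *ᵥ x.2.2) j + (ε + 1) * x.2.2 j + x.2.1 j =
          x.1.2.2.2.2 * legendreBit (-(p₀ : ℤ)) (j : ℕ) + ((ε + 1) * x.1.2.1 + x.1.2.2.1 + ∑ i : Q, x.2.2 i)) ∧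
      (∑ j : Q, legendreBit (-(p₀ : ℤ)) (j : ℕ) * x.2.1 j + (∑ j : Q, legendreBit (-(p₀ : ℤ)) (j : ℕ)) * x.1.2.2.2.1
          = x.1.1) ∧
      (∑ j : Q, legendreBit (-(p₀ : ℤ)) (j : ℕ) * x.2.2 j + (∑ j : Q, legendreBit (-(p₀ : ℤ)) (j : ℕ)) * x.1.2.2.2.2 +
          x.1.2.2.2.2 + x.1.2.2.2.1 + x.1.2.1 + x.1.2.2.1 = 0) ∧
      (x.1.2.2.2.1 + x.1.2.2.2.2 + x.1.2.1 + x.1.2.2.1 = x.1.1)} =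
    8 * Nat.card (LinearMap.ker (phi3 (borderedLaplacian Q p₀)).mulVecLin) := by
  classical
  -- preimages and transfer bits
  obtain ⟨w₁, h₁⟩ := exists_phi3_mulVec_eq_const Q p₀ hQ hQ4 hk
  obtain ⟨wπ, hπ⟩ := exists_phi3_mulVec_eq_border Q p₀ hQ hQ4 hk
  obtain ⟨hFP, hFfg, hfg⟩ := phi3_transfer_relations Q p₀ hQ hQ4 hk h₁ hπ
  set F := ∑ j : Q, w₁ j with hF
  set g := ∑ j : Q, legendreBit (-(p₀ : ℤ)) (j : ℕ) * w₁ j with hg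
  set f := ∑ j : Q, wπ j with hf
  set P := ∑ j : Q, legendreBit (-(p₀ : ℤ)) (j : ℕ) * wπ j with hP
  -- the predicate, the scalar condition, the base point
  set Sys : (ZMod 2 × ZMod 2 × ZMod 2 × ZMod 2 × ZMod 2) → ((Q → ZMod 2) × (Q → ZMod 2)) → Prop := fun s p =>
      (∀ j : Q, (borderedLaplacian Q p₀ *ᵥ p.1) j + ε * p.1 j + p.2 j =
          s.2.2.2.1 * legendreBit (-(p₀ : ℤ)) (j : ℕ) + (s.2.1 + ε * s.2.2.1 + ∑ i : Q, p.1 i)) ∧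
      (∀ j : Q, (borderedLaplacian Q p₀ *ᵥ p.2) j + (ε + 1) * p.2 j + p.1 j =
          s.2.2.2.2 * legendreBit (-(p₀ : ℤ)) (j : ℕ) + ((ε + 1) * s.2.1 + s.2.2.1 + ∑ i : Q, p.2 i)) ∧
      (∑ j : Q, legendreBit (-(p₀ : ℤ)) (j : ℕ) * p.1 j + (∑ j : Q, legendreBit (-(p₀ : ℤ)) (j : ℕ)) * s.2.2.2.1 = s.1) ∧
      (∑ j : Q, legendreBit (-(p₀ : ℤ)) (j : ℕ) * p.2 j + (∑ j : Q, legendreBit (-(p₀ : ℤ)) (j : ℕ)) * s.2.2.2.2 +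
          s.2.2.2.2 + s.2.2.2.1 + s.2.1 + s.2.2.1 = 0) ∧
      (s.2.2.2.1 + s.2.2.2.2 + s.2.1 + s.2.2.1 = s.1) with hSys
  set cond : (ZMod 2 × ZMod 2 × ZMod 2 × ZMod 2 × ZMod 2) → Prop := fun s =>
      (s.2.2.2.1 + s.2.2.2.2 + s.2.1 + s.2.2.1 = s.1) ∧
      ((ε * s.2.2.2.1 + s.2.2.2.2 + s.2.1 + ε * s.2.2.1 + (1 + ε) * s.1) * P + (s.2.2.1 + s.2.2.2.1 + s.1) * g = s.1) ∧
      ((ε * s.2.2.2.1 + s.2.2.2.2 + s.2.1 + ε * s.2.2.1 + (1 + ε) * s.1) * f + (s.2.2.1 + s.2.2.2.1 + s.1) * F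
        = (1 + ε) * s.1) with hcond
  -- Step 1: the solution set as a sigma type over the scalars
  have e1 : {x : (ZMod 2 × ZMod 2 × ZMod 2 × ZMod 2 × ZMod 2) × ((Q → ZMod 2) × (Q → ZMod 2)) // Sys x.1 x.2} ≃
      Σ s : ZMod 2 × ZMod 2 × ZMod 2 × ZMod 2 × ZMod 2, {p : (Q → ZMod 2) × (Q → ZMod 2) // Sys s p} :=
    Equiv.subtypeProdEquivSigmaSubtype Sys
  -- Step 2: each fibre
  have fibre : ∀ s : ZMod 2 × ZMod 2 × ZMod 2 × ZMod 2 × ZMod 2,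
      Nat.card {p : (Q → ZMod 2) × (Q → ZMod 2) // Sys s p} =
        if cond s then Nat.card (LinearMap.ker (phi3 (borderedLaplacian Q p₀)).mulVecLin) else 0 := by
    rintro ⟨σ, τ₁, τ₂, γ₁, γ₂⟩
    have key := fun χ₁ χ₂ : Q → ZMod 2 => sysC1_iff Q p₀ hQ hQ4 hk h₁ hπ ε σ τ₁ τ₂ γ₁ γ₂
      (ε * γ₁ + γ₂ + τ₁ + ε * τ₂ + (1 + ε) * σ) (τ₂ + γ₁ + σ) rfl rfl χ₁ χ₂
    set b : Q → ZMod 2 := fun j : Q => γ₁ + (ε * γ₁ + γ₂ + τ₁ + ε * τ₂ + (1 + ε) * σ) * wπ j +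
      (τ₂ + γ₁ + σ) * w₁ j with hb
    have hbb : ∀ v : Q → ZMod 2, v + b + b = v := fun v => by
      ext j; simp only [Pi.add_apply]; rw [add_assoc, CharTwo.add_self_eq_zero, add_zero]
    by_cases hc : cond (σ, τ₁, τ₂, γ₁, γ₂)
    · rw [if_pos hc]
      have hc' := hc
      simp only [hcond] at hc'
      refine Nat.card_congr
        { toFun := fun p => ⟨p.1.1 + b, by
            have h := ((key p.1.1 p.1.2).mp (by simpa [hSys] using p.2)).1
            rw [LinearMap.mem_ker, Matrix.mulVecLin_apply]; exact h⟩
          invFun := fun κ => ⟨(κ.1 + b, fun j : Q => (borderedLaplacian Q p₀ *ᵥ (κ.1 + b)) j + ε * (κ.1 + b) j +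
              γ₁ * legendreBit (-(p₀ : ℤ)) (j : ℕ) + (τ₁ + ε * τ₂ + (1 + ε) * σ)), by
            have hκ := κ.2
            rw [LinearMap.mem_ker, Matrix.mulVecLin_apply] at hκ
            have h := (key (κ.1 + b) _).mpr ⟨by rw [hbb]; exact hκ, fun j => rfl, hc'⟩
            simpa [hSys] using h⟩
          left_inv := fun p => by
            have h := (key p.1.1 p.1.2).mp (by simpa [hSys] using p.2)
            apply Subtype.ext
            refine Prod.ext (hbb p.1.1) ?_
            funext j
            change (borderedLaplacian Q p₀ *ᵥ (p.1.1 + b + b)) j + ε * (p.1.1 + b + b) j +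
              γ₁ * legendreBit (-(p₀ : ℤ)) (j : ℕ) + (τ₁ + ε * τ₂ + (1 + ε) * σ) = p.1.2 j
            rw [hbb, h.2.1 j]
          right_inv := fun κ => Subtype.ext (hbb κ.1) }
    · rw [if_neg hc, Nat.card_eq_zero]
      left
      constructor
      rintro ⟨⟨χ₁, χ₂⟩, hp⟩
      have h := (key χ₁ χ₂).mp (by simpa [hSys] using hp)
      exact hc (by simp only [hcond]; exact h.2.2)
  -- Step 3: sum over the scalars
  rw [Nat.card_congr e1, Nat.card_sigma, Finset.sum_congr rfl fun s _ => fibre s, Finset.sum_ite, Finset.sum_const_zero,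
    add_zero, Finset.sum_const, smul_eq_mul]
  congr 1
  have h8 := card_goodScalars ε f g F P hFP hFfg hfg
  convert h8 using 2

end Summit.BirchSwinnertonDyer.BirchSwinnertonDyer.Theorems.GenusKolyvaginAtTwo.FullVertex
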